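import Summits.HodgeConjecture.HodgeConjecture.Theorems.F0P3cStCharTSJacCartanModelFrame     -- ★ (C8b-frame): `skew_conj_iff`, `unitary_conj_iff`
import Literature.NumberTheory.Automorphic.UnitaryGroupAutomorphicRep                       -- ★ `unitaryGroupOfForm`, `mem_unitaryGroupOfForm_iff`
import Mathlib.LinearAlgebra.FiniteDimensional.Defs
import HarnessLib

/-!
# F0 · P3c · line LH6 «StCharTS» — WIF antecedent, ELLIPTIC half: brick (C8b-field) «THE FIXED FIELD OF `σ` AND THE `K^σ`-STRUCTURE ON `𝔲(σ,J)`»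

Cell `pub/hodgecm-mathlib`, crux H413 = `stmt-HodgeConjecture-24833` (lane `--supports … --as helper`); seat LH5-p02 (g6); ROAD «JAC-ELL» v1 §2 (model input of
★ (Q8) `exists_cartanLinearPart`, which needs a coefficient field `F` with `[FiniteDimensional F K]` over which `𝔲(σ,J)` is a submodule).  THEOREMS ONLY; Mathlib +
★ (C8b-frame) + ★ `UnitaryGroupAutomorphicRep`.

* `exists_fixedSubfield` — the fixed field `K^σ = {a | σ a = a}` of a ring endomorphism `σ` (as a `Subfield`, no definition introduced);
* `finiteDimensional_of_involutive` — for an INVOLUTION `σ` of a field of characteristic `≠ 2`, `K` is finite-dimensional over `K^σ` (spanned by `1, θ` with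
  `σ θ = −θ`, or `K^σ = K`);
* `exists_fixedSubmodule_skew` — `𝔲(σ,J) = {X | σ(X)ᵀ J + J X = 0}` is a `K^σ`-submodule of `M_n(K)`;
* `range_conj_skew_iff`, `range_conj_unitary_iff` — ★ (C4u)'s range descriptions for the CONJUGATED frame `Z ↦ Q Z Q⁻¹` on `𝔲(σ,J)` and `u ↦ Q u Q⁻¹` on
  `U(σ,J)`, relative to the conjugated form `J′ = σ(Q⁻¹)ᵀ J Q⁻¹` (★ C8b-frame `skew_conj_iff` ∕ `unitary_conj_iff`).

HONEST LABEL: count-neutral helper algebra; closes no organ; HC_CM is proved only modulo the printed citations (h413 = `stmt-HodgeConjecture-24833`) until rung 0 closes.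

## References
* [PlatonovRapinchuk1994] V. Platonov, A. Rapinchuk, *Algebraic Groups and Number Theory* (1994), §3.3 (unitary groups of hermitian forms over a quadratic
  extension, their Lie algebras as forms over the fixed field). Context locator.
-/

set_option autoImplicit false
set_option linter.dupNamespace false

open Set Matrix
open Literature.NumberTheory.Automorphic Literature.NumberTheory.Automorphic.UnitaryGroup
open Summit.HodgeConjecture.HodgeConjecture.Cruxes.H413.F0P3cStCharTSJacCartanModelFrame
open scoped MatrixGroups

namespace Summit.HodgeConjecture.HodgeConjecture.Cruxes.H413.F0P3cStCharTSJacCartanFixedField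

variable {K : Type*} [Field K] (σ : K →+* K)

/-- **The fixed field `K^σ`** of a ring endomorphism (no definition introduced). [cite: PlatonovRapinchuk1994, §3.3] -/
theorem exists_fixedSubfield : ∃ F : Subfield K, ∀ a, a ∈ F ↔ σ a = a := by
  refine ⟨{ carrier := {a | σ a = a}, mul_mem' := ?_, one_mem' := ?_, add_mem' := ?_, zero_mem' := ?_, neg_mem' := ?_, inv_mem' := ?_ },
    fun a => Iff.rfl⟩
  · intro a b ha hb; simp only [mem_setOf_eq] at ha hb ⊢; rw [map_mul, ha, hb]
  · simp
  · intro a b ha hb; simp only [mem_setOf_eq] at ha hb ⊢; rw [map_add, ha, hb]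
  · simp
  · intro a ha; simp only [mem_setOf_eq] at ha ⊢; rw [map_neg, ha]
  · intro a ha; simp only [mem_setOf_eq] at ha ⊢; rw [map_inv₀, ha]

/-- **`K` is finite-dimensional over the fixed field of an involution** (`char K ≠ 2`): `K = K^σ ⊕ K^σ θ` for any `θ ≠ 0` with `σ θ = −θ`, and `K = K^σ` if there
is none. [cite: PlatonovRapinchuk1994, §3.3] -/
theorem finiteDimensional_of_involutive (h2 : (2 : K) ≠ 0) (hσ2 : ∀ a, σ (σ a) = a) (F : Subfield K) (hF : ∀ a, a ∈ F ↔ σ a = a) :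
    FiniteDimensional ↥F K := by
  classical
  have hσ2' : σ 2 = 2 := by rw [← one_add_one_eq_two, map_add, map_one]
  by_cases hθ : ∃ θ : K, θ ≠ 0 ∧ σ θ = -θ
  · obtain ⟨θ, hθ0, hθσ⟩ := hθ
    refine ⟨⟨{1, θ}, ?_⟩⟩
    rw [eq_top_iff]
    rintro x -
    rw [Finset.coe_insert, Finset.coe_singleton]
    have ha : (x + σ x) / 2 ∈ F := by
      rw [hF, map_div₀, map_add, hσ2, hσ2', add_comm]
    have hb : (x - σ x) / (2 * θ) ∈ F := by
      rw [hF, map_div₀, map_sub, hσ2, map_mul, hσ2', hθσ, mul_neg, ← neg_sub, neg_div_neg_eq]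
    have hx : x = (⟨_, ha⟩ : ↥F) • (1 : K) + (⟨_, hb⟩ : ↥F) • θ := by
      show x = (x + σ x) / 2 * 1 + (x - σ x) / (2 * θ) * θ
      field_simp
      ring
    rw [hx]
    exact add_mem (Submodule.smul_mem _ _ (Submodule.subset_span (by simp))) (Submodule.smul_mem _ _ (Submodule.subset_span (by simp)))
  · push Not at hθ
    have hid : ∀ x, σ x = x := fun x => by
      by_contra hx
      have hne : x - σ x ≠ 0 := sub_ne_zero.2 (Ne.symm hx)
      exact hθ (x - σ x) hne (by rw [map_sub, hσ2, neg_sub])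
    refine ⟨⟨{1}, ?_⟩⟩
    rw [eq_top_iff]
    rintro x -
    rw [Finset.coe_singleton]
    have hx : x = (⟨x, (hF x).2 (hid x)⟩ : ↥F) • (1 : K) := by show x = x * 1; rw [mul_one]
    rw [hx]
    exact Submodule.smul_mem _ _ (Submodule.subset_span rfl)

variable {n : Type*} [Fintype n] [DecidableEq n] (J : Matrix n n K)

/-- **`𝔲(σ,J)` is a `K^σ`-submodule of `M_n(K)`** (no definition introduced). [cite: PlatonovRapinchuk1994, §3.3] -/
theorem exists_fixedSubmodule_skew (F : Subfield K) (hF : ∀ a, a ∈ F ↔ σ a = a) :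
    ∃ 𝔲 : Submodule ↥F (Matrix n n K), ∀ X, X ∈ 𝔲 ↔ (X.map σ)ᵀ * J + J * X = 0 := by
  refine ⟨{ carrier := {X | (X.map σ)ᵀ * J + J * X = 0}, add_mem' := ?_, zero_mem' := ?_, smul_mem' := ?_ }, fun X => Iff.rfl⟩
  · intro a b ha hb
    simp only [mem_setOf_eq] at ha hb ⊢
    rw [Matrix.map_add σ (map_add σ), Matrix.transpose_add, add_mul, mul_add, add_add_add_comm, ha, hb, add_zero]
  · simp
  · intro a X hX
    simp only [mem_setOf_eq] at hX ⊢
    have ha : σ (a : K) = a := (hF a).1 a.2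
    have hq : ((a : ↥F) • X).map σ = (a : K) • X.map σ := by
      ext i j; simp [Matrix.map_apply, Subfield.smul_def, ha]
    rw [hq, Matrix.transpose_smul, smul_mul_assoc, Subfield.smul_def, mul_smul_comm, ← smul_add, hX, smul_zero]

/-- **Range of the conjugated embedding of `𝔲`**: `X = Q Z Q⁻¹` with `Z ∈ 𝔲(σ,J)` iff `X ∈ 𝔲(σ,J′)`, `J′ = σ(Q⁻¹)ᵀ J Q⁻¹` (and `X` commutes with `1`).
[cite: PlatonovRapinchuk1994, §3.3] -/
theorem range_conj_skew_iff {R : Type*} [Semiring R] [Module R (Matrix n n K)] (Q : GL n K) {𝔲 : Submodule R (Matrix n n K)}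
    (h𝔲 : ∀ X, X ∈ 𝔲 ↔ (X.map σ)ᵀ * J + J * X = 0) (X : Matrix n n K) :
    X ∈ Set.range (fun Z : ↥𝔲 => (Q : Matrix n n K) * (Z : Matrix n n K) * ((Q⁻¹ : GL n K) : Matrix n n K)) ↔
      ((X.map σ)ᵀ * ((((Q⁻¹ : GL n K) : Matrix n n K).map σ)ᵀ * J * ((Q⁻¹ : GL n K) : Matrix n n K)) +
        ((((Q⁻¹ : GL n K) : Matrix n n K).map σ)ᵀ * J * ((Q⁻¹ : GL n K) : Matrix n n K)) * X = 0 ∧ X * 1 = 1 * X) := by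
  have key := fun Y : Matrix n n K => skew_conj_iff σ J Q⁻¹ Y
  simp only [inv_inv] at key
  have hQQ' : (Q : Matrix n n K) * ((Q⁻¹ : GL n K) : Matrix n n K) = 1 := by rw [← Units.val_mul, mul_inv_cancel, Units.val_one]
  have e : ∀ Y : Matrix n n K, (Q : Matrix n n K) * (((Q⁻¹ : GL n K) : Matrix n n K) * Y * (Q : Matrix n n K)) * ((Q⁻¹ : GL n K) : Matrix n n K) = Y := fun Y => by
    calc _ = ((Q : Matrix n n K) * ((Q⁻¹ : GL n K) : Matrix n n K)) * Y * ((Q : Matrix n n K) * ((Q⁻¹ : GL n K) : Matrix n n K)) := by noncomm_ring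
      _ = Y := by rw [hQQ', one_mul, mul_one]
  constructor
  · rintro ⟨Z, rfl⟩
    exact ⟨(key _).2 ((h𝔲 _).1 Z.2), by rw [mul_one, one_mul]⟩
  · rintro ⟨hX, -⟩
    have hY : ((Q⁻¹ : GL n K) : Matrix n n K) * X * (Q : Matrix n n K) ∈ 𝔲 := (h𝔲 _).2 ((key _).1 (by rw [e]; exact hX))
    exact ⟨⟨_, hY⟩, e X⟩

omit [DecidableEq n] in
/-- **Range of the conjugated representation**: `g = Q u Q⁻¹` with `u ∈ U(σ,J)` iff `g ∈ U(σ,J′)` (and `g` commutes with `1`). [cite: PlatonovRapinchuk1994, §3.3] -/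
theorem range_conj_unitary_iff [DecidableEq n] (Q : GL n K) (g : GL n K) :
    g ∈ Set.range (fun u : ↥(unitaryGroupOfForm σ J) => Q * (u : GL n K) * Q⁻¹) ↔
      ((((g : Matrix n n K)).map σ)ᵀ * ((((Q⁻¹ : GL n K) : Matrix n n K).map σ)ᵀ * J * ((Q⁻¹ : GL n K) : Matrix n n K)) * (g : Matrix n n K) =
          (((Q⁻¹ : GL n K) : Matrix n n K).map σ)ᵀ * J * ((Q⁻¹ : GL n K) : Matrix n n K) ∧
        (g : Matrix n n K) * 1 = 1 * (g : Matrix n n K)) := by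
  have key := fun h : Matrix n n K => unitary_conj_iff σ J Q⁻¹ h
  simp only [inv_inv] at key
  have hQQ' : (Q : Matrix n n K) * ((Q⁻¹ : GL n K) : Matrix n n K) = 1 := by rw [← Units.val_mul, mul_inv_cancel, Units.val_one]
  have e : (Q : Matrix n n K) * (((Q⁻¹ : GL n K) : Matrix n n K) * (g : Matrix n n K) * (Q : Matrix n n K)) * ((Q⁻¹ : GL n K) : Matrix n n K) = g := by
    calc _ = ((Q : Matrix n n K) * ((Q⁻¹ : GL n K) : Matrix n n K)) * (g : Matrix n n K) * ((Q : Matrix n n K) * ((Q⁻¹ : GL n K) : Matrix n n K)) := by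
          noncomm_ring
      _ = _ := by rw [hQQ', one_mul, mul_one]
  constructor
  · rintro ⟨u, rfl⟩
    refine ⟨?_, by rw [mul_one, one_mul]⟩
    rw [Units.val_mul, Units.val_mul]
    exact (key _).2 (mem_unitaryGroupOfForm_iff.1 u.2)
  · rintro ⟨hg, -⟩
    have hu : Q⁻¹ * g * Q ∈ unitaryGroupOfForm σ J := by
      rw [mem_unitaryGroupOfForm_iff, Units.val_mul, Units.val_mul]
      exact (key _).1 (by rw [e]; exact hg)
    exact ⟨⟨_, hu⟩, by show Q * (Q⁻¹ * g * Q) * Q⁻¹ = g; group⟩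

end Summit.HodgeConjecture.HodgeConjecture.Cruxes.H413.F0P3cStCharTSJacCartanFixedField
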